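import Summits.QuantumAdvantage.QuantumAdvantage.Theorems.CubicForrelationNearExactIsExactTwelveTypeOShape2932
import Summits.QuantumAdvantage.QuantumAdvantage.Theorems.CubicForrelationNearExactIsExactKtThreeForm
import Summits.QuantumAdvantage.QuantumAdvantage.Theorems.CubicForrelationNearExactIsExactTwelveQuadSpectrum
import Summits.QuantumAdvantage.QuantumAdvantage.Theorems.CubicForrelationNearExactIsExactMinWeightFlat

/-!
# Crux `CubicForrelation.NearExactIsExact` (stmt-QuantumAdvantage-14043) — n = 12: the character sums of a weight-`992` cubic support are `32·m(y)`
  with `m(y)` ODD exactly on a linear HYPERPLANE (classification-free: Kasami–Tokura structure for cubics + the quadratic Walsh tower)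

Certificate seat `b2b-cforr-cert` (gen 22).  HONEST FRAMING: a kernel-checked structure lemma (standard axioms, no `decide`) about Boolean cubics on
12 bits — infrastructure for the base-`992` configuration of the boundary rung `29/32` at `n = 12` (the type-O × level-`≥ 6` and type-O × level-5
kills of HOME/b2b-cforr-cert-g22/PLAN-N12-928-EQ.md, "FACT992").  NO new value of `θ₁₂`.  NOT summit progress.

`to22_char_sum_E992_structure`: let `c` be cubic on 12 bits with `#E = 992`, `E = {c = 1}`, and `Ê(y) = Σ_{x∈E} (−1)^{x·y}`.  Then `Ê(y) = 32·m(y)`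
for an integer function `m` and the set `M = {y : m(y) odd}` is an xor-closed set of `2048` points containing `0` (a linear hyperplane).
Proof.  `E` lies in an affine hyperplane `H = {⟨x,z⟩ = b}` (`kt3_structure_twelve`; `992 ≠ 896`), so `c = 1_H · q` with `q = c ⊕ c(· ⊕ v)` quadratic,
`v`-periodic, `⟨v,z⟩ = 1`, `#{q = 1} = 1984` (`kt3_hyperplane_form`).  Hence `W_q(0) = 4096 − 2·1984 = 128`, so by the quadratic tower
(`qs_spectrum`, `qs_parseval`) `W_q = 128·w` with `w ∈ {0, ±1}` supported on exactly `1024` points; this support is a Boolean function of degree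
`≤ 2` (`qs_walshTower2` at `j = 7`) of the minimum weight `2¹⁰` of `RM(2,12)`, hence a 10-flat through `0` (`mw_flat_of_minweight`), i.e. a
subspace `Σ`; `v`-periodicity gives `Σ ⊆ v^⊥`, so `z ∉ Σ`.  By the half-space formula (`qs_halfspace`)
`Ê(y) = 1024·([y = 0] + t[y = z]) − 32·(w(y) + t·w(y ⊕ z))` (`t = ±1` the sign of `b`), so `m(y) = 32(…) − (w(y) + t·w(y ⊕ z))` is odd iff
exactly one of `y`, `y ⊕ z` lies in `Σ`, iff `y ∈ M := Σ ∪ (z ⊕ Σ)` — a subspace of `2048` points.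

References: T. Kasami, N. Tokura (1970) Thm 1 (through the tree's `kt3_structure`, `kt3_hyperplane_form`); MacWilliams–Sloane (1977) Ch. 13 §3,
Ch. 15 §2 (quadratic forms); R. O'Donnell (2014) §3.3.  Everything below is proved from Mathlib and the tree; axioms are the standard three.
-/

set_option linter.dupNamespace false -- D-0017: single-problem summit ⇒ `QuantumAdvantage.QuantumAdvantage` by design

noncomputable section

namespace Summit.QuantumAdvantage.QuantumAdvantage.Theorems.CubicForrelation.NearExactIsExact

open Finset
open Literature.Computability.QuantumComplexity
open Literature.Computability.QuantumComplexity.BuzetChailloux (bxor zeroVec bxor_bxor_cancel_left bxor_zeroVec zeroVec_bxor bxor_comm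
  bxor_self twist_zeroVec_right twist_bxor_right bxorPerm bxorPerm_apply sum_twist_left)
open Literature.Computability.QuantumComplexity.DerivativeWalsh (W twist_bxor_left)
open Literature.Computability.QuantumComplexity.Simon (twist_eq_one_or twist_mul_self)

/-! ### Two small tools -/

/-- The Walsh transform of a `v`-periodic Boolean function vanishes off `v^⊥`: if `q(x ⊕ v) = q(x)` for all `x` and `(−1)^{v·y} = −1` then
`W_q(y) = 0`. [folklore] -/
theorem to22_W_periodic_zero {n : ℕ} (q : (Fin n → Bool) → Bool) (v : Fin n → Bool) (hper : ∀ x, q (bxor x v) = q x)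
    (y : Fin n → Bool) (hy : twist v y = -1) : W (fun x => signOf (q x)) y = 0 := by
  have hre : W (fun x => signOf (q x)) y = ∑ x, signOf (q (bxor v x)) * twist (bxor v x) y := by
    unfold W
    exact (Equiv.sum_comp (bxorPerm v) (fun x => signOf (q x) * twist x y)).symm
  have hre' : W (fun x => signOf (q x)) y = twist v y * W (fun x => signOf (q x)) y :=
    calc W (fun x => signOf (q x)) y = ∑ x, signOf (q (bxor v x)) * twist (bxor v x) y := hre
      _ = ∑ x, twist v y * (signOf (q x) * twist x y) :=
          sum_congr rfl fun x _ => by rw [bxor_comm v x, hper x, twist_bxor_left]; ring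
      _ = twist v y * W (fun x => signOf (q x)) y := by rw [← mul_sum]; rfl
  rw [hy] at hre'
  linarith

/-- `Σ_x (−1)^{q(x)} = 2^n − 2·#{q = 1}`. [folklore] -/
theorem to22_sum_signOf_eq {n : ℕ} (q : (Fin n → Bool) → Bool) :
    ∑ x, signOf (q x) = (2 : ℝ) ^ n - 2 * (#(univ.filter fun x => q x = true) : ℝ) := by
  have h : ∀ x, signOf (q x) = 1 - 2 * (if q x = true then (1 : ℝ) else 0) := by
    intro x; cases q x <;> norm_num [signOf]
  rw [sum_congr rfl fun x _ => h x, sum_sub_distrib, ← mul_sum, sum_boole, sum_const, card_univ, Fintype.card_fun, Fintype.card_bool,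
    Fintype.card_fin]
  norm_num

/-! ### The structure of the character sums of a weight-`992` cubic support -/

/-- **Character sums of a weight-`992` cubic support on 12 bits**: `Ê(y) = 32·m(y)` with `{y : m(y) odd}` an xor-closed set of `2048` points
containing `0`.  See the module docstring.  NOT summit progress. [this work] -/
theorem to22_char_sum_E992_structure (c : (Fin (6 + 6) → Bool) → Bool) (hc : IsDegLeFun 3 c)
    (h992 : #(univ.filter fun x => c x = true) = 992) :
    ∃ (mf : (Fin (6 + 6) → Bool) → ℤ) (M : Finset (Fin (6 + 6) → Bool)),
      (∀ y, ∑ x ∈ univ.filter (fun x => c x = true), twist x y = 32 * (mf y : ℝ)) ∧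
      zeroVec ∈ M ∧ (∀ a ∈ M, ∀ b ∈ M, bxor a b ∈ M) ∧ #M = 2048 ∧ ∀ y, (Odd (mf y) ↔ y ∈ M) := by
  classical
  set E := univ.filter (fun x => c x = true) with hEdef
  -- Kasami–Tokura: `E` lies in an affine hyperplane `{⟨x,z⟩ = b}`
  obtain ⟨z, b, hz, hH⟩ : ∃ (z : Fin (6 + 6) → Bool) (b : Bool), z ≠ zeroVec ∧
      ∀ x, c x = true → decide (Odd #(univ.filter fun i => (x i && z i) = true)) = b := by
    rcases kt3_structure_twelve c hc (by rw [h992]; norm_num) (by rw [h992]; norm_num) with h | h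
    · exact h
    · rw [h992] at h; norm_num at h
  -- the factorised form `c = 1_H · q`, `q` quadratic and `v`-periodic
  obtain ⟨v, hvz, hq, hperq, hcardq, hform⟩ := kt3_hyperplane_form (d := 2) c hc z hz b hH
  set q : (Fin (6 + 6) → Bool) → Bool := fun x => c x ^^ c (bxor x v) with hqdef
  have hper : ∀ x, q (bxor x v) = q x := fun x => hperq x
  have hcardq' : #(univ.filter fun x => q x = true) = 1984 := by
    change #(univ.filter fun x => (c x ^^ c (bxor x v)) = true) = 1984
    rw [hcardq, h992]
  -- `(−1)^{v·z} = −1`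
  have htvz : twist v z = -1 := by
    rw [vg_twist_eq_signOf, hvz]; rfl
  -- the spectrum of `q`: `W_q = 2^j w`, `w ∈ {0, ±1}`; `W_q(0) = 128` forces `j = 7`, `w(0) = 1`
  obtain ⟨j, hj6, hj12, w, hw, hwval, -⟩ := qs_spectrum q hq
  have hW0 : W (fun x => signOf (q x)) zeroVec = 128 := by
    unfold W
    rw [sum_congr rfl fun x _ => by rw [twist_zeroVec_right, mul_one], to22_sum_signOf_eq, hcardq']
    norm_num
  have hj7 : j = 7 ∧ w zeroVec = 1 := by
    have h := hw zeroVec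
    rw [hW0] at h
    rcases hwval zeroVec with h0 | h0 | h0 <;> rw [h0] at h <;> interval_cases j <;> norm_num at h
    exact ⟨rfl, h0⟩
  obtain ⟨hj, hw0⟩ := hj7
  subst hj
  -- Parseval: `Σ w² = 1024`, so the support `Σ` of `w` has `1024` points
  have hpars := qs_parseval q 7 w hw
  have hsumw : ∑ y, w y ^ 2 = 1024 := by
    have h : (2 : ℤ) ^ (2 * 7) * ∑ y, w y ^ 2 = 2 ^ 24 := hpars
    norm_num at h
    linarith
  set Sg := univ.filter (fun y : Fin (6 + 6) → Bool => decide (Odd (w y)) = true) with hSgdef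
  have hmemSg : ∀ y, y ∈ Sg ↔ w y ≠ 0 := by
    intro y
    rw [hSgdef, mem_filter]
    rcases hwval y with h | h | h <;> simp [h]
  have hcardSg : #Sg = 1024 := by
    have hsq : ∀ y, w y ^ 2 = if y ∈ Sg then 1 else 0 := by
      intro y
      rcases hwval y with h | h | h
      · rw [if_neg (fun hm => (hmemSg y).1 hm h), h]; norm_num
      · rw [if_pos ((hmemSg y).2 (by rw [h]; norm_num)), h]; norm_num
      · rw [if_pos ((hmemSg y).2 (by rw [h]; norm_num)), h]; norm_num
    rw [sum_congr rfl fun y _ => hsq y, sum_boole] at hsumw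
    have e : (univ.filter fun y => y ∈ Sg) = Sg := by ext y; simp
    rw [e] at hsumw
    exact_mod_cast hsumw
  -- the support is a Boolean function of degree `≤ 2` of minimum weight: a 10-flat through `0`, i.e. a subspace
  have hdegSg : IsDegLeFun 2 (fun y => decide (Odd (w y))) :=
    qs_walshTower2 (6 + 6) 7 2 q w hq hw (by intro k hk hkn; omega)
  have hmw := mw_flat_of_minweight 1 (fun y => decide (Odd (w y))) hdegSg (by rw [← hSgdef, hcardSg]; norm_num)
  rw [← hSgdef] at hmw
  obtain ⟨hV0, hVadd, hVcard, hVcoset⟩ := hmw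
  set VS := univ.filter (fun a : Fin (6 + 6) → Bool => ∀ x, decide (Odd (w (bxor x a))) = decide (Odd (w x))) with hVSdef
  have hSgV : Sg = VS := by
    have h := hVcoset zeroVec (by rw [hw0]; decide)
    rw [h]
    ext y
    constructor
    · intro hy
      obtain ⟨a, ha, rfl⟩ := mem_image.1 hy
      rw [zeroVec_bxor]; exact ha
    · intro hy
      exact mem_image.2 ⟨y, hy, zeroVec_bxor y⟩
  have hVcard' : #VS = 1024 := by rw [← hSgV, hcardSg]
  -- `v`-periodicity: the support lies in `v^⊥`; in particular `z ∉ Σ`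
  have hSperp : ∀ y, y ∈ VS → twist v y = 1 := by
    intro y hy
    rw [← hSgV, hmemSg] at hy
    rcases twist_eq_one_or v y with h | h
    · exact h
    · exfalso
      have h0 := to22_W_periodic_zero q v hper y h
      rw [hw y] at h0
      have : (w y : ℝ) = 0 := by
        have h2 : (2 : ℝ) ^ 7 ≠ 0 := by norm_num
        exact (mul_eq_zero.1 h0).resolve_left h2
      exact hy (by exact_mod_cast this)
  have hzS : ∀ y, y ∈ VS → bxor z y ∉ VS := by
    intro y hy hzy
    have h1 := hSperp y hy
    have h2 := hSperp _ hzy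
    rw [twist_bxor_right, htvz, h1] at h2
    norm_num at h2
  -- the half-space formulas
  set t : ℝ := signOf b with htdef
  have ht : t = 1 ∨ t = -1 := by cases b <;> simp [t]
  obtain ⟨tZ, htZ, htZval⟩ : ∃ tZ : ℤ, (tZ : ℝ) = t ∧ (tZ = 1 ∨ tZ = -1) := by
    rcases ht with h | h
    · exact ⟨1, by rw [h]; norm_num, Or.inl rfl⟩
    · exact ⟨-1, by rw [h]; norm_num, Or.inr rfl⟩
  have hHmem : ∀ x, (decide (Odd #(univ.filter fun i => (x i && z i) = true)) = b) ↔ twist z x = t := by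
    intro x
    have hfe : (univ.filter fun i => (z i && x i) = true) = (univ.filter fun i => (x i && z i) = true) :=
      filter_congr fun i _ => by rw [Bool.and_comm]
    rw [vg_twist_eq_signOf, hfe]
    simp only [t]
    generalize decide (Odd #(univ.filter fun i => (x i && z i) = true)) = d
    cases d <;> cases b <;> norm_num [signOf]
  -- `Ê(y)` as a half-space sum of `(1 − (−1)^q)/2`
  have hEsum : ∀ y, ∑ x ∈ E, twist x y =
      ∑ x ∈ univ.filter (fun x => twist z x = t), (1 - signOf (q x)) / 2 * twist x y := by
    intro y
    have hE' : E = (univ.filter (fun x => twist z x = t)).filter (fun x => q x = true) := by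
      ext x
      rw [hEdef, mem_filter, mem_filter, mem_filter]
      constructor
      · intro ⟨_, hx⟩
        have hf := hform x
        change c x = (decide (decide (Odd #(univ.filter fun i => (x i && z i) = true)) = b) && q x) at hf
        rw [hx] at hf
        have hf' := hf.symm
        rw [Bool.and_eq_true] at hf'
        exact ⟨⟨mem_univ _, (hHmem x).1 (of_decide_eq_true hf'.1)⟩, hf'.2⟩
      · rintro ⟨⟨-, hx⟩, hqx⟩
        refine ⟨mem_univ _, ?_⟩
        have hf := hform x
        rw [decide_eq_true ((hHmem x).2 hx), Bool.true_and] at hf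
        rw [hf]; exact hqx
    rw [hE', sum_filter]
    refine sum_congr rfl fun x _ => ?_
    by_cases hqx : q x = true
    · rw [if_pos hqx, hqx]; simp [signOf]
    · rw [if_neg hqx]
      have hqf : q x = false := by simpa using hqx
      rw [hqf]; simp [signOf]
  have hhalf1 : ∀ y, ∑ x ∈ univ.filter (fun x => twist z x = t), twist x y =
      2048 * ((if y = zeroVec then (1 : ℝ) else 0) + t * (if bxor z y = zeroVec then (1 : ℝ) else 0)) := by
    intro y
    have h := qs_halfspace (fun _ : Fin (6 + 6) → Bool => (1 : ℝ)) z t ht y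
    simp only [one_mul] at h
    rw [h]
    unfold W
    simp only [one_mul]
    rw [sum_twist_left, sum_twist_left]
    split_ifs <;> ring
  have hhalfq : ∀ y, ∑ x ∈ univ.filter (fun x => twist z x = t), signOf (q x) * twist x y =
      64 * ((w y : ℝ) + t * (w (bxor z y) : ℝ)) := by
    intro y
    rw [qs_halfspace (fun x => signOf (q x)) z t ht y, hw, hw]
    ring
  -- the integer function `m`
  set mf : (Fin (6 + 6) → Bool) → ℤ := fun y =>
    32 * ((if y = zeroVec then 1 else 0) + tZ * (if bxor z y = zeroVec then 1 else 0)) - (w y + tZ * w (bxor z y)) with hmfdef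
  have hEm : ∀ y, ∑ x ∈ E, twist x y = 32 * (mf y : ℝ) := by
    intro y
    rw [hEsum y]
    have e : ∑ x ∈ univ.filter (fun x => twist z x = t), (1 - signOf (q x)) / 2 * twist x y =
        (∑ x ∈ univ.filter (fun x => twist z x = t), twist x y) / 2 -
        (∑ x ∈ univ.filter (fun x => twist z x = t), signOf (q x) * twist x y) / 2 := by
      rw [Finset.sum_div, Finset.sum_div, ← sum_sub_distrib]
      exact sum_congr rfl fun x _ => by ring
    rw [e, hhalf1 y, hhalfq y]
    simp only [mf]
    push_cast
    rw [htZ]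
    split_ifs <;> ring
  -- the parity set `M = Σ ∪ (z ⊕ Σ)`
  set M := VS ∪ VS.image (bxor z) with hMdef
  have hmemM : ∀ y, y ∈ M ↔ (y ∈ VS ∨ bxor z y ∈ VS) := by
    intro y
    rw [hMdef, mem_union, mem_image]
    constructor
    · rintro (h | ⟨a, ha, rfl⟩)
      · exact Or.inl h
      · right; rw [bxor_bxor_cancel_left]; exact ha
    · rintro (h | h)
      · exact Or.inl h
      · exact Or.inr ⟨bxor z y, h, bxor_bxor_cancel_left z y⟩
  refine ⟨mf, M, hEm, ?_, ?_, ?_, ?_⟩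
  · exact (hmemM _).2 (Or.inl hV0)
  · intro a ha b' hb'
    rw [hmemM] at ha hb' ⊢
    have hzz : ∀ x y : Fin (6 + 6) → Bool, bxor (bxor z x) (bxor z y) = bxor x y := by
      intro x y; funext i; simp only [bxor]; cases x i <;> cases y i <;> cases z i <;> rfl
    have hz1 : ∀ x y : Fin (6 + 6) → Bool, bxor (bxor z x) y = bxor z (bxor x y) := by
      intro x y; funext i; simp only [bxor]; cases x i <;> cases y i <;> cases z i <;> rfl
    have hz2 : ∀ x y : Fin (6 + 6) → Bool, bxor x (bxor z y) = bxor z (bxor x y) := by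
      intro x y; funext i; simp only [bxor]; cases x i <;> cases y i <;> cases z i <;> rfl
    rcases ha with ha | ha <;> rcases hb' with hb | hb
    · exact Or.inl (hVadd a ha b' hb)
    · right; rw [← hz2]; exact hVadd a ha _ hb
    · right; rw [← hz1]; exact hVadd _ ha b' hb
    · left; rw [← hzz]; exact hVadd _ ha _ hb
  · rw [hMdef, card_union_of_disjoint, card_image_of_injective _ (fun x y h => by
        have := congrArg (bxor z) h; rwa [bxor_bxor_cancel_left, bxor_bxor_cancel_left] at this), hVcard']
    rw [disjoint_left]
    intro y hy hy'
    obtain ⟨a, ha, rfl⟩ := mem_image.1 hy'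
    exact hzS a ha hy
  · intro y
    rw [hmemM]
    have hmem1 : y ∈ VS ↔ w y ≠ 0 := by rw [← hSgV]; exact hmemSg y
    have hmem2 : bxor z y ∈ VS ↔ w (bxor z y) ≠ 0 := by rw [← hSgV]; exact hmemSg _
    have hnot : ¬ (w y ≠ 0 ∧ w (bxor z y) ≠ 0) := fun h => hzS y (hmem1.2 h.1) (hmem2.2 h.2)
    have hevpart : Even (32 * ((if y = zeroVec then 1 else 0) + tZ * (if bxor z y = zeroVec then 1 else 0)) : ℤ) :=
      ⟨16 * ((if y = zeroVec then 1 else 0) + tZ * (if bxor z y = zeroVec then 1 else 0)), by ring⟩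
    have h32 := Int.not_odd_iff_even.2 hevpart
    have hpar : Odd (mf y) ↔ Odd (w y + tZ * w (bxor z y)) := by
      simp only [mf]
      rw [Int.odd_sub]
      constructor
      · intro h
        exact Int.not_even_iff_odd.1 fun hB => h32 (h.2 hB)
      · intro hB
        exact ⟨fun h32' => absurd h32' h32, fun hE => absurd hE (Int.not_even_iff_odd.2 hB)⟩
    rw [hpar, hmem1, hmem2]
    rcases hwval y with h1 | h1 | h1 <;> rcases hwval (bxor z y) with h2 | h2 | h2 <;> rcases htZval with h3 | h3 <;>
      simp only [h1, h2, h3] at hnot ⊢ <;> norm_num [Int.odd_iff] at hnot <;> norm_num [Int.odd_iff]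

end Summit.QuantumAdvantage.QuantumAdvantage.Theorems.CubicForrelation.NearExactIsExact

end
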